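import Summits.Ventures.PercRepro.PuncturedLYMMatching

/-!
# PercRepro — (SP) FOR `j = 2`: THE COLUMN SUMS OF THE MATCHING WEIGHTS ARE EXACTLY `1`
(p10, gen 30; continues PuncturedLYMMatching)

* `mW_eq_half_of_touched`, `sum_subsP_mW_touched` — a touched triple has exactly two `P`-subsets, each of weight `1/2`;
* `subsP_eq_image_erase`, `kOf_erase`, `sum_subsP_mW_untouched` — the `P`-subsets of an untouched triple `Y` are its
  three `2`-subsets `Y.erase y`; with `k = k(Y)` matched points the column sum is `k·a(k−1) + (3−k)·b(k) = 1` in each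
  of the four cases `k = 0, 1, 2, 3` (by the definitions `b 1 = (1 − a 0)/2`, `a 1 = (1 − b 2)/2`, `b 0 = a 2 = 1/3`).
Nothing here asserts (SP) for `j ≥ 3`.
-/

namespace PercRepro.PuncturedLYM

open Finset

variable {α : Type} [Fintype α] [DecidableEq α]

/-! ### Column sums -/

/-- For `X ⊆ Y` with `#Y = #X + 1` and `Y` touched, `mW X Y = 1/2`. -/
theorem mW_eq_half_of_touched {D : Finset (Finset α)} {X Y : Finset α} (hXY : X ⊆ Y) (hc : Y.card = X.card + 1)
    (hT : Touched D Y) : mW α D X Y = 1 / 2 := by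
  unfold mW
  have h1 : (Y \ X).card = 1 := by
    rw [card_sdiff_of_subset hXY]
    omega
  obtain ⟨y, hy⟩ := card_eq_one.1 h1
  rw [hy, sum_singleton]
  have hyY : y ∈ Y \ X := hy ▸ mem_singleton_self y
  rw [mem_sdiff] at hyY
  have hins : insert y X = Y := by
    apply eq_of_subset_of_card_le (insert_subset hyY.1 hXY)
    rw [card_insert_of_notMem hyY.2, hc]
  unfold omW
  rw [hins, if_pos hT]

/-- The column sum at a touched triple is `1`: two `P`-subsets of weight `1/2`. -/
theorem sum_subsP_mW_touched {D : Finset (Finset α)} (hD : IsCode 2 D) {Y : Finset α} (hY : Y.card = 3)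
    (hT : Touched D Y) : ∑ X ∈ subsP 2 D Y, mW α D X Y = 1 := by
  have hc := card_subsP hD (j := 2) hY
  rw [if_pos hT] at hc
  have h2 : (subsP 2 D Y).card = 2 := by omega
  have h3 : ∀ X ∈ subsP 2 D Y, mW α D X Y = 1 / 2 := by
    intro X hX
    obtain ⟨⟨hXc, -⟩, hXY⟩ := mem_subsP.1 hX
    exact mW_eq_half_of_touched hXY (by omega) hT
  rw [sum_congr rfl h3, sum_const, h2, nsmul_eq_mul]
  norm_num

/-- The `P`-subsets of an untouched triple are its three `2`-subsets `Y.erase y`. -/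
theorem subsP_eq_image_erase {D : Finset (Finset α)} {Y : Finset α} (hY : Y.card = 3) (hT : ¬ Touched D Y) :
    subsP 2 D Y = Y.image (fun y => Y.erase y) := by
  ext X
  simp only [mem_subsP, mem_image]
  constructor
  · rintro ⟨⟨hXc, -⟩, hXY⟩
    have h1 : (Y \ X).card = 1 := by
      rw [card_sdiff_of_subset hXY]
      omega
    obtain ⟨y, hy⟩ := card_eq_one.1 h1
    have hyY : y ∈ Y \ X := hy ▸ mem_singleton_self y
    rw [mem_sdiff] at hyY
    refine ⟨y, hyY.1, ?_⟩
    symm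
    apply eq_of_subset_of_card_le
    · intro z hz
      rw [mem_erase]
      refine ⟨?_, hXY hz⟩
      rintro rfl
      exact hyY.2 hz
    · rw [card_erase_of_mem hyY.1, hY, hXc]
  · rintro ⟨y, hyY, rfl⟩
    refine ⟨⟨by rw [card_erase_of_mem hyY, hY], ?_⟩, erase_subset y Y⟩
    intro hD'
    exact hT ⟨Y.erase y, hD', erase_subset y Y⟩

omit [Fintype α] in
/-- `y ↦ Y.erase y` is injective on `Y`. -/
theorem erase_injOn (Y : Finset α) : Set.InjOn (fun y => Y.erase y) (Y : Set α) := by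
  intro y hy y' hy' h
  have h' : Y.erase y = Y.erase y' := h
  by_contra hne
  have : y' ∈ Y.erase y := mem_erase.2 ⟨Ne.symm hne, hy'⟩
  rw [h', mem_erase] at this
  exact this.1 rfl

omit [Fintype α] in
/-- `Y \ Y.erase y = {y}` for `y ∈ Y`. -/
theorem sdiff_erase_eq_singleton {Y : Finset α} {y : α} (hy : y ∈ Y) : Y \ Y.erase y = {y} := by
  ext z
  simp only [mem_sdiff, mem_erase, not_and, mem_singleton]
  constructor
  · rintro ⟨hz, h⟩
    by_contra hne
    exact h hne hz
  · rintro rfl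
    exact ⟨hy, fun h _ => h rfl⟩

omit [Fintype α] in
/-- `k(Y.erase y) = k(Y) − [y ∈ M]`. -/
theorem kOf_erase (D : Finset (Finset α)) {Y : Finset α} {y : α} (hy : y ∈ Y) :
    kOf D (Y.erase y) + (if y ∈ matchedPts D then 1 else 0) = kOf D Y := by
  unfold kOf
  rw [erase_inter]
  split_ifs with hyM
  · rw [card_erase_of_mem (mem_inter.2 ⟨hy, hyM⟩)]
    have : 0 < (Y ∩ matchedPts D).card := card_pos.2 ⟨y, mem_inter.2 ⟨hy, hyM⟩⟩
    omega
  · rw [erase_eq_of_notMem (fun h => hyM (mem_inter.1 h).2), add_zero]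

/-- The column sum at an untouched triple is `1`: with `k = k(Y)` matched points it is `k·a(k−1) + (3−k)·b(k)`. -/
theorem sum_subsP_mW_untouched {D : Finset (Finset α)} {Y : Finset α} (hY : Y.card = 3)
    (hT : ¬ Touched D Y) : ∑ X ∈ subsP 2 D Y, mW α D X Y = 1 := by
  rw [subsP_eq_image_erase hY hT, sum_image (erase_injOn Y)]
  have h1 : ∀ y ∈ Y, mW α D (Y.erase y) Y =
      if y ∈ matchedPts D then aW α D (kOf D Y - 1) else bW α D (kOf D Y) := by
    intro y hy
    unfold mW
    rw [sdiff_erase_eq_singleton hy, sum_singleton]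
    unfold omW
    rw [insert_erase hy, if_neg hT]
    have hk := kOf_erase D hy
    split_ifs with hyM
    · rw [if_pos hyM] at hk
      have : kOf D (Y.erase y) = kOf D Y - 1 := by omega
      rw [this]
    · rw [if_neg hyM, add_zero] at hk
      rw [hk]
  rw [sum_congr rfl h1, sum_ite, sum_const, sum_const, nsmul_eq_mul, nsmul_eq_mul]
  have hkY : (Y.filter (fun y => y ∈ matchedPts D)).card = kOf D Y := by
    unfold kOf
    rw [filter_mem_eq_inter]
  have hkY' : (Y.filter (fun y => ¬ y ∈ matchedPts D)).card = 3 - kOf D Y := by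
    have := card_filter_add_card_filter_not (fun y => y ∈ matchedPts D) (s := Y)
    rw [hY] at this
    omega
  have hk3 : kOf D Y ≤ 3 := hY ▸ kOf_le D Y
  rw [hkY, hkY']
  have ha2 : aW α D 2 = 1 / 3 := rfl
  have hb0 : bW α D 0 = 1 / 3 := rfl
  have ha0 : aW α D 0 = a0 α D := rfl
  have ha1 : aW α D 1 = (1 - b2 α D) / 2 := rfl
  have hb1 : bW α D 1 = (1 - a0 α D) / 2 := rfl
  have hb2 : bW α D 2 = b2 α D := rfl
  have hb3 : bW α D 3 = b2 α D := rfl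
  rcases (by omega : kOf D Y = 0 ∨ kOf D Y = 1 ∨ kOf D Y = 2 ∨ kOf D Y = 3) with h | h | h | h <;> rw [h] <;> norm_num
  · rw [hb0]; norm_num
  · rw [ha0, hb1]; ring
  · rw [ha1, hb2]; ring
  · rw [ha2]; norm_num

end PercRepro.PuncturedLYM
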